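import Summits.CriticalPhenomena.PercolationContinuityZ3.Theorems.PercNearOneGluingAdditiveGluingGenPair
import Literature.Probability.Percolation.KozmaNitzanSeparatingTriple
import HarnessLib

/-!
# KN Question 8 at `|A| = 3`: the atom (T*) for the `x`-class WITHOUT a frame

Support file (`--supports stmt-CriticalPhenomena-4575`, closed crux; independent mathematics on Kozma–Nitzan's Question 8 at
`|A| = 3`, arXiv:2401.12397 §5.5 p. 36), prover `prim-ineq-gen-7` (gen 13).  No definitions, no named facts, no sorries; standard axioms.
Memos `prim-ineq-gen-7/FINDING-TSTAR-g12.md` §2, §8 and `FINDING-TSTAR2-g13.md` §4.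

Setting (memo FINDING-TSTAR-g12 §0 at `Y = ∅`): one percolation `μ = prodBernoulli w`, owner `x`, observers `o, v`, `f = F(C x)` with `F`
monotone and nonnegative on vertex sets; the five cells of the connection pattern of `x, o, v`:
`O = {x↔o}`, `E = {x↮o} ∩ {o↔v}`, `PV = {x↮o} ∩ {o↮v} ∩ {x↔v}`, `PM = {x↮o} ∩ {o↮v} ∩ {x↮v}`; `O2 = O ⊔ E = {o↔x} ∪ {o↔v}`,
`P = PV ⊔ PM = {o↮x} ∩ {o↮v}`.  The open atom (T*) of the Question-8-at-three-relays chain is, for a function `g` and in the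
denominator-free cubic form of FINDING-TSTAR2-g13 §0 (★★),
      `μ(PM)·( μ(P)·∫_O g − μ(O2)·∫_{PV} g )  ≥  ( μ(O)μ(PM) − μ(E)μ(PV) )·∫_{PM} g`,
equivalently `law(·|O) ≽ β·law(·|PV) + (1−β)·law(·|PM)` with `β = μ(O2)μ(PV)/(μ(O)μ(P))`.
* `PocketCert.xclass_k2b_frameless` — **K2b for the `x`-class**: `μ(PM)·∫_E F(C x) ≤ μ(E)·∫_{PM} F(C x)`, i.e.
  `E[F(C x) | E] ≤ E[F(C x) | PM]`: one application of van den Berg–Häggström–Kahn's Theorem 1.4/2.1 (`q = 1`) with `S = {x}`, `T = {o, v}`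
  (`F(C x)` increasing in `C_S`, `1{o↔v}` increasing in `C_T`, negatively correlated on `{S ↮ T} = E ⊔ PM`).
* `PocketCert.tstar_xclass_frameless` — **(T*) for every increasing nonnegative `F(C x)` at `Y = ∅`**: Harris for the increasing event
  `O2 = {x↔o} ∪ {o↔v}` (`AGloc.setIntegral_clusterFun_ge`) gives `μ(P)·∫_{O2} f ≥ μ(O2)·∫_P f`; with K2b, `μ(PM)`-times the first plus
  `μ(P)`-times the second is the claim.
With a frame `{x,o} ↮ Y`, `Y ≠ ∅`, K2b FAILS (exact census 24/127 at `|Y| = 1`) and (T*) for the `x`-class is open: the whole difficulty of the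
covariance half (T1) of the five-point inequality is the frame (FINDING-TSTAR2-g13 §4).
[cite: VandenbergHaggstromKahn2005, Thm. 1.4 (p. 7), Thm. 2.1 (p. 9)] [cite: KozmaNitzan2024, Question 8 (§5.5 p. 36)]
-/

namespace Summit.CriticalPhenomena.PercolationContinuityZ3.Theorems

open MeasureTheory Set Literature.Probability.LatticeModels Literature.Probability.Percolation
open scoped Classical
open KNPreFKG

noncomputable section

namespace PocketCert

variable {V : Type*} [Fintype V]

/-- **K2b for the `x`-class, no frame.**  `μ(PM)·∫_E F(C x) ≤ μ(E)·∫_{PM} F(C x)` with `E = {x↮o} ∩ {o↔v}`,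
`PM = {x↮o} ∩ {o↮v} ∩ {x↮v}`: vdBHK Thm 1.4/2.1 (`q = 1`) for `S = {x}`, `T = {o,v}` on `{S↮T} = E ⊔ PM`.
[cite: VandenbergHaggstromKahn2005, Thm. 1.4 (p. 7), Thm. 2.1 (p. 9)] -/
theorem xclass_k2b_frameless (w : Sym2 V → unitInterval) (x o v : V) (F : Set V → ℝ)
    (hF : ∀ S T : Set V, S ⊆ T → F S ≤ F T) :
    (prodBernoulli w).real ({ω : BondConfig V | ¬ (openGraph ω).Reachable x o} ∩ {ω | ¬ (openGraph ω).Reachable o v} ∩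
        {ω | ¬ (openGraph ω).Reachable x v}) *
      ∫ ω in {ω : BondConfig V | ¬ (openGraph ω).Reachable x o} ∩ openConn o v, F (openCluster ω x) ∂(prodBernoulli w) ≤
    (prodBernoulli w).real ({ω : BondConfig V | ¬ (openGraph ω).Reachable x o} ∩ openConn o v) *
      ∫ ω in {ω : BondConfig V | ¬ (openGraph ω).Reachable x o} ∩ {ω | ¬ (openGraph ω).Reachable o v} ∩
        {ω | ¬ (openGraph ω).Reachable x v}, F (openCluster ω x) ∂(prodBernoulli w) := by
  classical
  set μ := prodBernoulli w with hμ
  set f : BondConfig V → ℝ := fun ω => F (openCluster ω x) with hf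
  have hmeas : ∀ S' : Set (BondConfig V), MeasurableSet S' := fun _ => MeasurableSet.of_discrete
  have hint : ∀ (g : BondConfig V → ℝ) (S' : Set (BondConfig V)), IntegrableOn g S' μ :=
    fun g S' => (Integrable.of_finite).integrableOn
  have hn := fun (S' : Set (BondConfig V)) => (measureReal_nonneg : 0 ≤ μ.real S')
  -- the cells
  set Ev : Set (BondConfig V) := {ω : BondConfig V | ¬ (openGraph ω).Reachable x o} ∩ openConn o v with hEv
  set PM : Set (BondConfig V) := {ω : BondConfig V | ¬ (openGraph ω).Reachable x o} ∩
    {ω | ¬ (openGraph ω).Reachable o v} ∩ {ω | ¬ (openGraph ω).Reachable x v} with hPM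
  set D : Set (BondConfig V) := {ω : BondConfig V | ¬ (openGraph ω).Reachable x o ∧ ¬ (openGraph ω).Reachable x v}
    with hD
  -- `D ∩ {o↔v} = E`, `D = E ⊔ PM`
  have hDE : D ∩ openConn o v = Ev := by
    ext ω
    simp only [hD, hEv, mem_inter_iff, mem_setOf_eq, openConn]
    constructor
    · rintro ⟨⟨hxo, -⟩, hov⟩
      exact ⟨hxo, hov⟩
    · rintro ⟨hxo, hov⟩
      exact ⟨⟨hxo, fun hxv => hxo (hxv.trans hov.symm)⟩, hov⟩
  have hDsplit : D = Ev ∪ PM := by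
    ext ω
    simp only [hD, hEv, hPM, mem_inter_iff, mem_union, mem_setOf_eq, openConn]
    constructor
    · rintro ⟨hxo, hxv⟩
      by_cases hov : (openGraph ω).Reachable o v
      · exact Or.inl ⟨hxo, hov⟩
      · exact Or.inr ⟨⟨hxo, hov⟩, hxv⟩
    · rintro (⟨hxo, hov⟩ | ⟨⟨hxo, hov⟩, hxv⟩)
      · exact ⟨hxo, fun hxv => hxo (hxv.trans hov.symm)⟩
      · exact ⟨hxo, hxv⟩
  have hdisj : Disjoint Ev PM := by
    rw [Set.disjoint_left]
    rintro ω ⟨-, hov⟩ ⟨⟨-, hov'⟩, -⟩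
    exact hov' hov
  have eD : μ.real D = μ.real Ev + μ.real PM := by rw [hDsplit, measureReal_union hdisj (hmeas _)]
  have iD : ∫ ω in D, f ω ∂μ = ∫ ω in Ev, f ω ∂μ + ∫ ω in PM, f ω ∂μ := by
    rw [hDsplit, setIntegral_union hdisj (hmeas _) (hint _ _) (hint _ _)]
  -- vdBHK Thm 2.1, `S = {x}`, `T = {o, v}`
  set S : Set V := {x} with hS
  set T : Set V := {o, v} with hT
  set Fe : Set (Sym2 V) → ℝ := fun C => F (openCluster C x) with hFe
  set Ge : Set (Sym2 V) → ℝ := fun C => if (openGraph C).Reachable o v then 1 else 0 with hGe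
  have hFe_mono : Monotone Fe := fun C C' hCC' => hF _ _ (openCluster_mono hCC' x)
  have hGe_mono : Monotone Ge := by
    intro C C' hCC'
    simp only [hGe]
    by_cases h : (openGraph C).Reachable o v
    · rw [if_pos h, if_pos (h.mono (openGraph_mono hCC'))]
    · rw [if_neg h]; split_ifs <;> norm_num
  have hD_ST : {ω : BondConfig V | ∀ s ∈ S, ∀ t ∈ T, ¬ (openGraph ω).Reachable s t} = D := by
    ext ω
    simp only [hS, hT, hD, mem_setOf_eq, mem_singleton_iff, mem_insert_iff, forall_eq, forall_eq_or_imp]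
  have hFe_eq : ∀ ω : BondConfig V, Fe (⋃ s ∈ S, openEdgeCluster ω s) = f ω := by
    intro ω
    simp only [hFe, hf]
    congr 1
    ext a
    exact (KNSep.reachable_iff_cluster ω S (show x ∈ S by simp [hS]) a).symm
  have hGe_eq : ∀ ω : BondConfig V, Ge (⋃ t ∈ T, openEdgeCluster ω t) =
      (openConn o v : Set (BondConfig V)).indicator 1 ω := by
    intro ω
    simp only [hGe]
    rw [← KNSep.reachable_iff_cluster ω T (show o ∈ T by simp [hT]) v]
    by_cases h : (openGraph ω).Reachable o v
    · rw [if_pos h, indicator_of_mem (show ω ∈ openConn o v from h), Pi.one_apply]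
    · rw [if_neg h, indicator_of_notMem (show ω ∉ openConn o v from h)]
  have hBHK := BHK2006_twoSetConditionalAssociation.negCorrelation w S T Fe Ge hFe_mono hGe_mono
  rw [hD_ST] at hBHK
  simp_rw [hFe_eq, hGe_eq] at hBHK
  rw [setIntegral_mul_indicator_one μ D (openConn o v) f, setIntegral_indicator_one_eq μ D (openConn o v),
    hDE] at hBHK
  -- hBHK : μ D * ∫_E f ≤ (∫_D f) * μ E
  change μ.real D * ∫ ω in Ev, f ω ∂μ ≤ (∫ ω in D, f ω ∂μ) * μ.real Ev at hBHK
  rw [eD, iD] at hBHK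
  -- (e + pM)·IE ≤ (IE + IPM)·e  ⇒  pM·IE ≤ e·IPM
  nlinarith [hBHK, hn Ev, hn PM]

/-- **(T*) for the `x`-class without a frame.**  `F` monotone nonnegative on vertex sets, `f = F(C x)`; cells
`O = {x↔o}`, `E = {x↮o}∩{o↔v}`, `PV = {x↮o}∩{o↮v}∩{x↔v}`, `PM = {x↮o}∩{o↮v}∩{x↮v}`.  Then
`μ(PM)·( (μ(PV)+μ(PM))·∫_O f − (μ(O)+μ(E))·∫_{PV} f ) ≥ ( μ(O)μ(PM) − μ(E)μ(PV) )·∫_{PM} f`,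
i.e. `law(C x | O) ≽ β·law(C x | PV) + (1−β)·law(C x | PM)`, `β = μ(O2)μ(PV)/(μ(O)μ(P))` — the atom (T*) of the KN-Question-8 chain
for `g = F(C x)` at `Y = ∅`.  Harris on `{x↔o} ∪ {o↔v}` plus `xclass_k2b_frameless`.
[cite: VandenbergHaggstromKahn2005, Thm. 1.4 (p. 7), Thm. 2.1 (p. 9)] [cite: KozmaNitzan2024, Question 8 (§5.5 p. 36)] -/
theorem tstar_xclass_frameless (w : Sym2 V → unitInterval) (x o v : V) (F : Set V → ℝ)
    (hF : ∀ S T : Set V, S ⊆ T → F S ≤ F T) (hF0 : ∀ S, 0 ≤ F S) :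
    ((prodBernoulli w).real (openConn x o) *
        (prodBernoulli w).real ({ω : BondConfig V | ¬ (openGraph ω).Reachable x o} ∩
          {ω | ¬ (openGraph ω).Reachable o v} ∩ {ω | ¬ (openGraph ω).Reachable x v}) -
      (prodBernoulli w).real ({ω : BondConfig V | ¬ (openGraph ω).Reachable x o} ∩ openConn o v) *
        (prodBernoulli w).real ({ω : BondConfig V | ¬ (openGraph ω).Reachable x o} ∩
          {ω | ¬ (openGraph ω).Reachable o v} ∩ openConn x v)) *
      ∫ ω in {ω : BondConfig V | ¬ (openGraph ω).Reachable x o} ∩ {ω | ¬ (openGraph ω).Reachable o v} ∩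
        {ω | ¬ (openGraph ω).Reachable x v}, F (openCluster ω x) ∂(prodBernoulli w) ≤
    (prodBernoulli w).real ({ω : BondConfig V | ¬ (openGraph ω).Reachable x o} ∩
        {ω | ¬ (openGraph ω).Reachable o v} ∩ {ω | ¬ (openGraph ω).Reachable x v}) *
      (((prodBernoulli w).real ({ω : BondConfig V | ¬ (openGraph ω).Reachable x o} ∩
            {ω | ¬ (openGraph ω).Reachable o v} ∩ openConn x v) +
          (prodBernoulli w).real ({ω : BondConfig V | ¬ (openGraph ω).Reachable x o} ∩
            {ω | ¬ (openGraph ω).Reachable o v} ∩ {ω | ¬ (openGraph ω).Reachable x v})) *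
          ∫ ω in openConn x o, F (openCluster ω x) ∂(prodBernoulli w) -
        ((prodBernoulli w).real (openConn x o) +
          (prodBernoulli w).real ({ω : BondConfig V | ¬ (openGraph ω).Reachable x o} ∩ openConn o v)) *
          ∫ ω in {ω : BondConfig V | ¬ (openGraph ω).Reachable x o} ∩ {ω | ¬ (openGraph ω).Reachable o v} ∩
            openConn x v, F (openCluster ω x) ∂(prodBernoulli w)) := by
  classical
  set μ := prodBernoulli w with hμ
  set f : BondConfig V → ℝ := fun ω => F (openCluster ω x) with hf
  have hmeas : ∀ S' : Set (BondConfig V), MeasurableSet S' := fun _ => MeasurableSet.of_discrete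
  have hint : ∀ (g : BondConfig V → ℝ) (S' : Set (BondConfig V)), IntegrableOn g S' μ :=
    fun g S' => (Integrable.of_finite).integrableOn
  have hn := fun (S' : Set (BondConfig V)) => (measureReal_nonneg : 0 ≤ μ.real S')
  have hfi := fun (S' : Set (BondConfig V)) =>
    (setIntegral_nonneg (hmeas S') fun ω _ => hF0 (openCluster ω x) : 0 ≤ ∫ ω in S', f ω ∂μ)
  -- the cells
  set O : Set (BondConfig V) := openConn x o with hO
  set Ev : Set (BondConfig V) := {ω : BondConfig V | ¬ (openGraph ω).Reachable x o} ∩ openConn o v with hEv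
  set PV : Set (BondConfig V) := {ω : BondConfig V | ¬ (openGraph ω).Reachable x o} ∩
    {ω | ¬ (openGraph ω).Reachable o v} ∩ openConn x v with hPV
  set PM : Set (BondConfig V) := {ω : BondConfig V | ¬ (openGraph ω).Reachable x o} ∩
    {ω | ¬ (openGraph ω).Reachable o v} ∩ {ω | ¬ (openGraph ω).Reachable x v} with hPM
  set P : Set (BondConfig V) := {ω : BondConfig V | ¬ (openGraph ω).Reachable x o} ∩
    {ω | ¬ (openGraph ω).Reachable o v} with hP
  set U2 : Set (BondConfig V) := openConn x o ∪ openConn o v with hU2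
  -- set algebra
  have hU2eq : U2 = O ∪ Ev := by
    ext ω
    simp only [hU2, hO, hEv, mem_union, mem_inter_iff, mem_setOf_eq, openConn]
    constructor
    · rintro (hxo | hov)
      · exact Or.inl hxo
      · by_cases hxo : (openGraph ω).Reachable x o
        · exact Or.inl hxo
        · exact Or.inr ⟨hxo, hov⟩
    · rintro (hxo | ⟨-, hov⟩)
      · exact Or.inl hxo
      · exact Or.inr hov
  have hdOE : Disjoint O Ev := by
    rw [Set.disjoint_left]
    rintro ω hxo ⟨hxo', -⟩
    exact hxo' hxo
  have hPeq : P = PV ∪ PM := by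
    ext ω
    simp only [hP, hPV, hPM, mem_union, mem_inter_iff, mem_setOf_eq, openConn]
    constructor
    · rintro ⟨hxo, hov⟩
      by_cases hxv : (openGraph ω).Reachable x v
      · exact Or.inl ⟨⟨hxo, hov⟩, hxv⟩
      · exact Or.inr ⟨⟨hxo, hov⟩, hxv⟩
    · rintro (⟨⟨hxo, hov⟩, -⟩ | ⟨⟨hxo, hov⟩, -⟩) <;> exact ⟨hxo, hov⟩
  have hdVM : Disjoint PV PM := by
    rw [Set.disjoint_left]
    rintro ω ⟨-, hxv⟩ ⟨-, hxv'⟩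
    exact hxv' hxv
  have hUniv : (univ : Set (BondConfig V)) = U2 ∪ P := by
    ext ω
    simp only [hU2, hP, mem_univ, mem_union, mem_inter_iff, mem_setOf_eq, openConn, true_iff]
    by_cases hxo : (openGraph ω).Reachable x o
    · exact Or.inl (Or.inl hxo)
    · by_cases hov : (openGraph ω).Reachable o v
      · exact Or.inl (Or.inr hov)
      · exact Or.inr ⟨hxo, hov⟩
  have hdUP : Disjoint U2 P := by
    rw [Set.disjoint_left]
    rintro ω hU ⟨hxo, hov⟩
    simp only [hU2, mem_union, openConn, mem_setOf_eq] at hU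
    rcases hU with h | h
    · exact hxo h
    · exact hov h
  have eU2 : μ.real U2 = μ.real O + μ.real Ev := by rw [hU2eq, measureReal_union hdOE (hmeas _)]
  have iU2 : ∫ ω in U2, f ω ∂μ = ∫ ω in O, f ω ∂μ + ∫ ω in Ev, f ω ∂μ := by
    rw [hU2eq, setIntegral_union hdOE (hmeas _) (hint _ _) (hint _ _)]
  have eP : μ.real P = μ.real PV + μ.real PM := by rw [hPeq, measureReal_union hdVM (hmeas _)]
  have iP : ∫ ω in P, f ω ∂μ = ∫ ω in PV, f ω ∂μ + ∫ ω in PM, f ω ∂μ := by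
    rw [hPeq, setIntegral_union hdVM (hmeas _) (hint _ _) (hint _ _)]
  have eTot : μ.real U2 + μ.real P = 1 := by
    rw [← measureReal_union hdUP (hmeas _), ← hUniv, probReal_univ]
  have iTot : ∫ ω, f ω ∂μ = ∫ ω in U2, f ω ∂μ + ∫ ω in P, f ω ∂μ := by
    rw [← setIntegral_univ, hUniv, setIntegral_union hdUP (hmeas _) (hint _ _) (hint _ _)]
  -- (1) Harris on the increasing event `U2 = {x↔o} ∪ {o↔v}`
  have hHarris : μ.real U2 * ∫ ω, f ω ∂μ ≤ ∫ ω in U2, f ω ∂μ :=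
    AGloc.setIntegral_clusterFun_ge w x F hF hF0 U2 ((isUpperSet_openConn x o).union (isUpperSet_openConn o v))
  -- (2) K2b
  have hK2b := xclass_k2b_frameless w x o v F hF
  change μ.real PM * ∫ ω in Ev, f ω ∂μ ≤ μ.real Ev * ∫ ω in PM, f ω ∂μ at hK2b
  -- (3) assemble:  pM·[π(IO+IE) − (a+e)(IPV+IPM)] + π·[e·IPM − pM·IE] = the claim
  rw [iTot, iU2, iP, eU2] at hHarris
  have h1 : 0 ≤ (μ.real PV + μ.real PM) * (∫ ω in O, f ω ∂μ + ∫ ω in Ev, f ω ∂μ) -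
      (μ.real O + μ.real Ev) * (∫ ω in PV, f ω ∂μ + ∫ ω in PM, f ω ∂μ) := by
    have h1' : (μ.real O + μ.real Ev) * (∫ ω in PV, f ω ∂μ + ∫ ω in PM, f ω ∂μ) ≤
        (1 - (μ.real O + μ.real Ev)) * (∫ ω in O, f ω ∂μ + ∫ ω in Ev, f ω ∂μ) := by nlinarith [hHarris]
    have h1'' : 1 - (μ.real O + μ.real Ev) = μ.real PV + μ.real PM := by linarith [eTot, eU2, eP]
    rw [h1''] at h1'
    linarith
  have h2 : 0 ≤ μ.real Ev * ∫ ω in PM, f ω ∂μ - μ.real PM * ∫ ω in Ev, f ω ∂μ := by linarith [hK2b]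
  change (μ.real O * μ.real PM - μ.real Ev * μ.real PV) * ∫ ω in PM, f ω ∂μ ≤
    μ.real PM * ((μ.real PV + μ.real PM) * ∫ ω in O, f ω ∂μ - (μ.real O + μ.real Ev) * ∫ ω in PV, f ω ∂μ)
  nlinarith [mul_nonneg (hn PM) h1, mul_nonneg (add_nonneg (hn PV) (hn PM)) h2, hn PM, hn PV, hn O, hn Ev,
    hfi O, hfi Ev, hfi PV, hfi PM]

end PocketCert

end

end Summit.CriticalPhenomena.PercolationContinuityZ3.Theorems
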